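import Literature.NumberTheory.GaloisRepresentations.LubinTateInvariantDifferential
import Literature.NumberTheory.GaloisRepresentations.LubinTateColemanTrace
import Literature.NumberTheory.GaloisRepresentations.LubinTateNormOperator
import HarnessLib

/-!
# Coleman's logarithmic derivative `δg = ω_F · g'/g` and the identity `𝒮(δg) = π · δ(𝒩g)`

De Shalit, *Iwasawa theory of elliptic curves with complex multiplication* (1987), Ch. I §3.12
(Corollary: "the map `δg = (1+X)g'/g = D log g` maps `{g : 𝒩g = g^φ}` onto `{h : 𝒮h = h^φ}`") and
§4.2 (Wiles' explicit reciprocity law, `δg = (1/λ') · g'/g`).  For the Lubin–Tate group of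
`f = πX + X^q` over the valuation ring `𝒪[F]` of ANY non-archimedean local field `F` (the tree's
absolute setting `LTCoeff F`, Coleman operators `colemanNorm` / `colemanTrace` at a level `n`), this
file defines **Coleman's logarithmic derivative** of a unit `g ∈ 𝒪[F]⟦X⟧ˣ`,
`logDeriv hπ g = ω_F · g'/g` (`ω_F = invDiff` the invariant differential `= 1/λ_f'`,
`LubinTateInvariantDifferential.lean`), and PROVES:

* `logDeriv_mul`, `logDeriv_one`, `logDeriv_map_C` — `δ` is a homomorphism killing `𝒪[F]ˣ`;
* `invDiff_mul_derivative_ltSer` — `ω_F · f' = π · ω_F ∘ f` in `𝒪[F]⟦X⟧`;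
* `logDeriv_eq_of_eq_subst_hom` — **`δ(g ∘ [a]_f) = a · (δg) ∘ [a]_f`** (`𝒪[F]`-equivariance; with
  `g_{σβ} = g_β ∘ [κ σ]` this is the `κ`-semilinearity behind de Shalit I §3.5 (ii));
* ★ `colemanTrace_logDeriv` — **`𝒮(δg) = π · δ(𝒩g)`** for every unit `g`: the logarithmic derivative
  (for the invariant derivation) of `(𝒩g) ∘ f = ∏_{ω ∈ W_f^1} g(X [+] ω)`, translation invariance of `ω_F`
  giving `Σ_ω (δg)(X [+] ω) = (𝒮 δg) ∘ f` and `[π]`-equivariance giving `π · (δ𝒩g) ∘ f`;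
* ★ `colemanTrace_logDeriv_of_colemanNorm_eq` — **`𝒩g = g ⟹ 𝒮(δg) = π · δg`**: `δ` maps Coleman's
  `𝒩`-invariant units `ℳ_f` (`≅ 𝒰 = lim← U(K_π^{n+1})`, `LubinTateColemanEquiv.lean`) into the
  `𝒮`-eigenseries `ℰ_π = {h : 𝒮h = πh}` (tree normalisation `(𝒮h) ∘ f = Σ_ω h(X [+] ω)`, no `1/p`).

This is the log-free form of the multiplicative-to-additive bridge of de Shalit I §3.3–3.12 (there via
`log g` and `D`; `D log g = δg`), the first half of Cor. I.3.12 in the absolute case; no parity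
hypothesis on `p`.  Everything here is proved (0 sorry).

## References

* E. de Shalit, *Iwasawa theory of elliptic curves with complex multiplication* (1987), Ch. I §3.5,
  §3.12 (Lemma, Corollary), §4.2. [deShalit1987]
* R. Coleman, *Division values in local fields*, Invent. Math. 53 (1979) 91–116. [Coleman1979]
* S. Lang, *Cyclotomic Fields I and II* (1990), Ch. 8 §2. [Lang1990]

## Tree reuse

`LubinTateInvariantDifferential.lean` (`invDiff`, `transl_invDiff`, `invDiff_mul_derivative_hom`,
`PowerSeries.dlog*`), `LubinTateColemanTrace.lean` (`colemanTrace`, `map_subst_colemanTrace`, `nSum`),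
`LubinTateNormOperator.lean` (`map_subst_colemanNorm`, `colemanNormHom`), `LubinTateColeman.lean`
(`transl`, `tPt`, `subst_injective`, `subst_C_mul`), `LubinTateColemanDerivative.lean` (`derivative_transl`).
-/

noncomputable section

open Filter Topology
open scoped PowerSeries.WithPiTopology

/-! ## Coleman's logarithmic derivative `δ` and the norm / trace operators -/

namespace PowerSeries

/-- `d⁄dX` commutes with coefficientwise maps (private copy of a tree one-liner). [folklore] -/
private theorem derivative_map' {R T : Type*} [CommRing R] [CommRing T] (φ : R →+* T) (G : R⟦X⟧) :
    d⁄dX T (G.map φ) = (d⁄dX R G).map φ := by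
  ext n
  simp only [coeff_derivative, coeff_map, map_mul, map_add, map_natCast, map_one]

end PowerSeries

namespace Literature.NumberTheory.GaloisRepresentations

section LocalFieldLogDeriv

open GaloisRepresentations.IsNonarchimedeanLocalField LubinTate ValuativeRel

variable (F : Type*) [Field F] [ValuativeRel F] [TopologicalSpace F] [IsNonarchimedeanLocalField F]

attribute [local instance] ltNormUniformSpace ltNormIsUniformAddGroup rk1 nF nE fintypeResidueField

variable {F}
variable {π : 𝒪[F]} (hπ : (valuation F).IsUniformizer (π : F)) (n : ℕ)

/-- **Coleman's logarithmic derivative** `δg := ω_F · g'/g ∈ 𝒪[F]⟦X⟧` of a unit `g` of `𝒪[F]⟦X⟧`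
(`ω_F = 1/λ'` the invariant differential of `F_f`, `f = πX + X^q`): de Shalit's `δg = D log g`
(I §3.12) and Wiles' `δg = (1/λ')·g'/g` (I §4.2). [cite: deShalit1987, Ch. I §3.12] -/
def logDeriv (g : (PowerSeries (LTCoeff F))ˣ) : PowerSeries (LTCoeff F) :=
  invDiff (isLTRing_LTCoeff hπ) (isLTSeries_LTCoeff π) * PowerSeries.dlog g

/-- Unfolding `logDeriv`. [cite: deShalit1987, Ch. I §3.12] -/
theorem logDeriv_def (g : (PowerSeries (LTCoeff F))ˣ) :
    logDeriv hπ g = invDiff (isLTRing_LTCoeff hπ) (isLTSeries_LTCoeff π) * PowerSeries.dlog g := rfl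

/-- `δ` is a homomorphism: `δ(g g') = δg + δg'`. [cite: deShalit1987, Ch. I §3.12] -/
theorem logDeriv_mul (g g' : (PowerSeries (LTCoeff F))ˣ) :
    logDeriv hπ (g * g') = logDeriv hπ g + logDeriv hπ g' := by
  rw [logDeriv, logDeriv, logDeriv, PowerSeries.dlog_mul, mul_add]

/-- `δ 1 = 0`. [cite: deShalit1987, Ch. I §3.12] -/
theorem logDeriv_one : logDeriv hπ (1 : (PowerSeries (LTCoeff F))ˣ) = 0 := by
  rw [logDeriv, PowerSeries.dlog_one, mul_zero]

/-- `δ` kills the constants `𝒪[F]ˣ`. [cite: deShalit1987, Ch. I §3.12] -/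
theorem logDeriv_map_C (u : (LTCoeff F)ˣ) :
    logDeriv hπ (Units.map (PowerSeries.C (R := LTCoeff F)).toMonoidHom u) = 0 := by
  simp [logDeriv, PowerSeries.dlog_def, Units.coe_map]

/-- **`ω_F · f' = π · ω_F ∘ f`** in `𝒪[F]⟦X⟧` for `f = πX + X^q` (the `[π]`-equivariance of the
invariant derivation, `[π]_f = f`). [cite: deShalit1987, Ch. I §3.5] -/
theorem invDiff_mul_derivative_ltSer :
    invDiff (isLTRing_LTCoeff hπ) (isLTSeries_LTCoeff π) * PowerSeries.derivative (LTCoeff F) (ltSer F π) =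
      PowerSeries.C (LTCoeff.of F π) *
        (invDiff (isLTRing_LTCoeff hπ) (isLTSeries_LTCoeff π)).subst (ltSer F π) := by
  have h := invDiff_mul_derivative_hom (S := unitBall (ltField π 0)) (isLTRing_LTCoeff hπ)
    (isLTSeries_LTCoeff π) (algebraMap_LTCoeff_injective (ltField π 0)) (LTCoeff.of F π)
  rwa [hom_self_eq] at h


/-- **`𝒪[F]`-equivariance of `δ`**: `δ(g ∘ [a]_f) = a · (δg) ∘ [a]_f` (so, with Coleman's
`g_{σβ} = g_β ∘ [κ(σ)]_f`, `δ` is semilinear for the character `κ`; de Shalit I §3.5 (ii) for the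
Coates–Wiles homomorphisms). [cite: deShalit1987, Ch. I §3.5] -/
theorem logDeriv_eq_of_eq_subst_hom (a : 𝒪[F]) (g H : (PowerSeries (LTCoeff F))ˣ)
    (hH : (H : PowerSeries (LTCoeff F)) =
      (g : PowerSeries (LTCoeff F)).subst
        (hom (isLTRing_LTCoeff hπ) (isLTSeries_LTCoeff π) (isLTSeries_LTCoeff π) (LTCoeff.of F a))) :
    logDeriv hπ H = PowerSeries.C (LTCoeff.of F a) *
      (logDeriv hπ g).subst
        (hom (isLTRing_LTCoeff hπ) (isLTSeries_LTCoeff π) (isLTSeries_LTCoeff π) (LTCoeff.of F a)) := by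
  set hA := isLTRing_LTCoeff (F := F) hπ with hA_def
  set hf := isLTSeries_LTCoeff (F := F) π with hf_def
  have hs : PowerSeries.HasSubst (hom hA hf hf (LTCoeff.of F a)) :=
    PowerSeries.HasSubst.of_constantCoeff_zero' (constantCoeff_hom hA hf hf _)
  have key := invDiff_mul_derivative_hom (S := unitBall (ltField π 0)) hA hf
    (algebraMap_LTCoeff_injective (ltField π 0)) (LTCoeff.of F a)
  rw [logDeriv, logDeriv, ← hA_def, ← hf_def, PowerSeries.dlog_eq_of_subst_eq hs g H hH,
    PowerSeries.subst_mul hs]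
  calc invDiff hA hf * ((PowerSeries.dlog g).subst (hom hA hf hf (LTCoeff.of F a)) *
        PowerSeries.derivative (LTCoeff F) (hom hA hf hf (LTCoeff.of F a)))
      = (invDiff hA hf * PowerSeries.derivative (LTCoeff F) (hom hA hf hf (LTCoeff.of F a))) *
          (PowerSeries.dlog g).subst (hom hA hf hf (LTCoeff.of F a)) := by ring
    _ = PowerSeries.C (LTCoeff.of F a) * (invDiff hA hf).subst (hom hA hf hf (LTCoeff.of F a)) *
          (PowerSeries.dlog g).subst (hom hA hf hf (LTCoeff.of F a)) := by rw [key]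
    _ = _ := by ring

/-- `δ(g ∘ f) = π · (δg) ∘ f` (`f = [π]_f`). [cite: deShalit1987, Ch. I §3.5] -/
theorem logDeriv_eq_of_eq_subst_ltSer (g H : (PowerSeries (LTCoeff F))ˣ)
    (hH : (H : PowerSeries (LTCoeff F)) = (g : PowerSeries (LTCoeff F)).subst (ltSer F π)) :
    logDeriv hπ H = PowerSeries.C (LTCoeff.of F π) * (logDeriv hπ g).subst (ltSer F π) := by
  have e := hom_self_eq (isLTRing_LTCoeff hπ) (isLTSeries_LTCoeff π)
  have := logDeriv_eq_of_eq_subst_hom hπ π g H (by rw [e]; exact hH)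
  rwa [e] at this

/-- ★★★ **Coleman's logarithmic derivative intertwines the norm and the trace operator**:
`𝒮(δg) = π · δ(𝒩g)` for every unit `g ∈ 𝒪[F]⟦X⟧ˣ` (`f = πX + X^q`, any local field `F`).
Differentiate `(𝒩g) ∘ f = ∏_{ω ∈ W_f^1} g(X [+] ω)` logarithmically with the invariant derivation:
translation invariance turns the right side into `Σ_ω (δg)(X [+] ω) = (𝒮 δg) ∘ f`, `[π]`-equivariance
turns the left side into `π · (δ 𝒩g) ∘ f`.  (De Shalit I §3.12: "if `𝒩g = g^φ` then `𝒮(δg) = (δg)^φ`",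
in the absolute case and with the tree's normalisation `(𝒮h) ∘ f = Σ h(X [+] ω)` of the trace.)
[cite: deShalit1987, Ch. I §3.12] -/
theorem colemanTrace_logDeriv (g : (PowerSeries (LTCoeff F))ˣ) :
    colemanTrace hπ n (logDeriv hπ g) =
      PowerSeries.C (LTCoeff.of F π) * logDeriv hπ (Units.map (colemanNormHom hπ n) g) := by
  -- notation
  set A := LTCoeff F
  set hA := isLTRing_LTCoeff (F := F) hπ with hA_def
  set hf := isLTSeries_LTCoeff (F := F) π with hf_def
  set S := unitBall (ltField π n)
  set M := maxNilIdeal F (ltField π n)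
  set ι : A →+* S := algebraMap A S with hι
  set fS : PowerSeries S := (ltSer F π).map ι with hfS
  have hfs : PowerSeries.HasSubst (ltSer F π) :=
    PowerSeries.HasSubst.of_constantCoeff_zero' (isLTSeries_ltSer π).constantCoeff_eq_zero
  have hfS0 : PowerSeries.constantCoeff fS = 0 :=
    constantCoeff_map_eq_zero _ (isLTSeries_ltSer π).constantCoeff_eq_zero
  have hfSs : PowerSeries.HasSubst fS := PowerSeries.HasSubst.of_constantCoeff_zero' hfS0
  -- reduce to an identity in `𝒪_{K_π^{n+1}}⟦X⟧` after substituting `f`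
  refine subst_injective hA (isLTSeries_ltSer π) ?_
  change PowerSeries.subst (ltSer F π) (colemanTrace hπ n (logDeriv hπ g)) =
    PowerSeries.subst (ltSer F π) (PowerSeries.C (LTCoeff.of F π) *
      logDeriv hπ (Units.map (colemanNormHom hπ n) g))
  refine PowerSeries.map_injective ι (algebraMap_LTCoeff_injective (ltField π n)) ?_
  rw [map_subst_colemanTrace]
  -- the units `g(X [+] ω_c)` of `S⟦X⟧` and their product `ι((𝒩g) ∘ f)`
  let gT : 𝓀[F] → (PowerSeries S)ˣ := fun c =>
    Units.map (evalAt (A := A) (seriesNilIdeal M) (tPt M hA hf (ltDivPt hπ n c))).toRingHom.toMonoidHom g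
  have hgT : ∀ c, ((gT c : (PowerSeries S)ˣ) : PowerSeries S) = transl M hA hf (ltDivPt hπ n c) g :=
    fun c => rfl
  -- `dlog (g(X [+] ω)) = (dlog g)(X [+] ω) · (X [+] ω)'`
  have hdlogT : ∀ c, PowerSeries.dlog (gT c) =
      transl M hA hf (ltDivPt hπ n c) (PowerSeries.dlog g) *
        PowerSeries.derivative S ((tPt M hA hf (ltDivPt hπ n c) : (seriesNilIdeal M).toIdeal) :
          PowerSeries S) := fun c =>
    PowerSeries.dlog_eq_of_map
      (evalAt (A := A) (seriesNilIdeal M) (tPt M hA hf (ltDivPt hπ n c))).toRingHom _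
      (fun G => derivative_transl M hA hf (ltDivPt hπ n c) G) g (gT c) (hgT c)
  -- each summand: `(δg)(X [+] ω) = ι ω_F · dlog (g(X [+] ω))` by translation invariance of `ω_F`
  have hsummand : ∀ c, transl M hA hf (ltDivPt hπ n c) (logDeriv hπ g) =
      (invDiff hA hf).map ι * PowerSeries.dlog (gT c) := by
    intro c
    rw [logDeriv, ← hA_def, ← hf_def, transl, map_mul, ← transl, ← transl, transl_invDiff, hdlogT]
    ring
  have hL : nSum M hA hf (ltDivPt hπ n) (logDeriv hπ g) =
      (invDiff hA hf).map ι * PowerSeries.dlog (∏ c, gT c) := by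
    rw [nSum, PowerSeries.dlog_prod, Finset.mul_sum]
    exact Finset.sum_congr rfl fun c _ => hsummand c
  -- the product of the translates is `ι((𝒩g) ∘ f) = (ι 𝒩g) ∘ ι f`
  set Ng : (PowerSeries A)ˣ := Units.map (colemanNormHom hπ n) g with hNg
  have hNgval : (Ng : PowerSeries A) = colemanNorm hπ n (g : PowerSeries A) := rfl
  let NgS : (PowerSeries S)ˣ := Units.map (PowerSeries.map ι).toMonoidHom Ng
  have hNgS : ((NgS : (PowerSeries S)ˣ) : PowerSeries S) = (Ng : PowerSeries A).map ι := rfl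
  have e1 : PowerSeries.map ι (PowerSeries.subst (ltSer F π) (colemanNorm hπ n (g : PowerSeries A))) =
      PowerSeries.subst fS ((colemanNorm hπ n (g : PowerSeries A)).map ι) := PowerSeries.map_subst hfs _
  have hprod : (((∏ c, gT c) : (PowerSeries S)ˣ) : PowerSeries S) = (NgS : PowerSeries S).subst fS := by
    rw [Units.coe_prod, hNgS, hNgval, ← e1, map_subst_colemanNorm]
    rfl
  have hdlogProd : PowerSeries.dlog (∏ c, gT c) =
      ((PowerSeries.dlog Ng).map ι).subst fS * PowerSeries.derivative S fS := by
    rw [PowerSeries.dlog_eq_of_subst_eq hfSs NgS _ hprod, PowerSeries.dlog_eq_of_map_eq ι Ng NgS hNgS]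
  -- `[π]`-equivariance of `ω_F`, mapped to `S⟦X⟧`: `ι ω_F · (ι f)' = ι π · (ι ω_F) ∘ ι f`
  have hequiv : (invDiff hA hf).map ι * PowerSeries.derivative S fS =
      PowerSeries.C (ι (LTCoeff.of F π)) * ((invDiff hA hf).map ι).subst fS := by
    have e2 : PowerSeries.map ι (PowerSeries.subst (ltSer F π) (invDiff hA hf)) =
        PowerSeries.subst fS ((invDiff hA hf).map ι) := PowerSeries.map_subst hfs _
    have h := congrArg (PowerSeries.map ι) (invDiff_mul_derivative_ltSer hπ)
    rw [← hA_def, ← hf_def, map_mul, map_mul, PowerSeries.map_C, e2, ← PowerSeries.derivative_map',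
      ← hfS] at h
    exact h
  -- assemble
  have e3 : PowerSeries.map ι (PowerSeries.subst (ltSer F π) (logDeriv hπ Ng)) =
      PowerSeries.subst fS ((logDeriv hπ Ng).map ι) := PowerSeries.map_subst hfs _
  rw [hL, hdlogProd, ← mul_assoc, mul_right_comm, hequiv, subst_C_mul (isLTSeries_ltSer π), map_mul,
    PowerSeries.map_C, e3, logDeriv, ← hA_def, ← hf_def, map_mul, PowerSeries.subst_mul hfSs]
  ring

/-- ★ **`𝒩g = g ⟹ 𝒮(δg) = π · δg`**: Coleman's logarithmic derivative maps the `𝒩`-invariant units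
`ℳ_f` (= the norm-coherent units `𝒰`, Coleman's theorem) into the `𝒮`-eigenseries
`{h : 𝒮h = π h}` — the map of de Shalit I Cor. 3.12 in the absolute case.
[cite: deShalit1987, Ch. I §3.12 Corollary] -/
theorem colemanTrace_logDeriv_of_colemanNorm_eq (g : (PowerSeries (LTCoeff F))ˣ)
    (hg : colemanNorm hπ n (g : PowerSeries (LTCoeff F)) = g) :
    colemanTrace hπ n (logDeriv hπ g) = PowerSeries.C (LTCoeff.of F π) * logDeriv hπ g := by
  rw [colemanTrace_logDeriv]
  congr 2
  exact Units.ext hg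

end LocalFieldLogDeriv

end Literature.NumberTheory.GaloisRepresentations
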